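import Summits.AtomisticToContinuum.Crystallization.Theorems.FrustratedLawDichotomyStrainedPatchHomForceCentredLeafB

/-!
# (C′-2) FORCE/EXEMPT PRUNE, centred form — soundness IV: the family sums `famA_sound` / `famB_sound`
# (27623 strained-patch piece, hcp half; decomp-a2c hand-2 g28)

* §1 `sum_box11_eq_nested'` (any additive commutative monoid), `famA_sound` / `famB_sound` — the nested single-pass folds `famA` / `famB` dominate
  the two `[−11,11]³` box sums of the slope kernel up to the signed first-order functionals (three applications of `…Sound.foldAcc_sound` per family);
* the assembly `forceOutC_sound_of_parts` (certificates `checkA`/`checkB` + `boundC` ⟹ the `hver` prune disjunct) is the sequel `…HomForceCentredFinal`.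
NO definitions; 0 sorry; axioms standard.  `--supports stmt-AtomisticToContinuum-27623`.
-/

namespace Summit.AtomisticToContinuum.Crystallization.Theorems.FrustratedLawDichotomyStrainedPatchHomForceCentredFam

open scoped BigOperators RealInnerProductSpace
open Literature.Analysis.ValidatedNumerics.Numerics
open Summit.AtomisticToContinuum.Crystallization.Theorems.ChargedEnergyGapNegative (E3)
open Summit.AtomisticToContinuum.Crystallization.Theorems.FrustratedLawDichotomyAveragingRuleTightFree (TightNearCap BadNearCap)
open Summit.AtomisticToContinuum.Crystallization.Theorems.FrustratedLawDichotomyExemptAbsorption (ExemptNear)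
open Summit.AtomisticToContinuum.Crystallization.Theorems.FrustratedLawDichotomyStrainedPatchHomSplit
open Summit.AtomisticToContinuum.Crystallization.Theorems.FrustratedLawDichotomyStrainedPatchHomEntryGram (entryFI mem_entryFI)
open Summit.AtomisticToContinuum.Crystallization.Theorems.FrustratedLawDichotomyStrainedPatchHomEntryGramHcp (dot3 mem_dot3 shufFI mem_shufFI)
open Summit.AtomisticToContinuum.Crystallization.Theorems.FrustratedLawDichotomyStrainedPatchHomForceKit
open Summit.AtomisticToContinuum.Crystallization.Theorems.FrustratedLawDichotomyStrainedPatchHomForceSum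
  (cutSlope box11 icc11 slopeTestOK dirOK lt_threshold_of_slopeTestOK norm_dirVec_le_one)
open Summit.AtomisticToContinuum.Crystallization.Theorems.FrustratedLawDichotomyStrainedPatchHomExemptMove (exemptNear_of_boxSlope)
open Summit.AtomisticToContinuum.Crystallization.Theorems.FrustratedLawDichotomyStrainedPatchHomForceNest (vec3_eta)
open Summit.AtomisticToContinuum.Crystallization.Theorems.FrustratedLawDichotomyStrainedPatchHomForceCentred
open Summit.AtomisticToContinuum.Crystallization.Theorems.FrustratedLawDichotomyStrainedPatchHomForceCentredSound
open Summit.AtomisticToContinuum.Crystallization.Theorems.FrustratedLawDichotomyStrainedPatchHomForceCentredLeaf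
open Summit.AtomisticToContinuum.Crystallization.Theorems.FrustratedLawDichotomyStrainedPatchHomForceCentredLeafB

/-! ## §1. Family sums -/

set_option maxRecDepth 8000 in
/-- A sum over `box11 = icc11³` is the nested triple sum (any additive commutative monoid). [folklore] -/
theorem sum_box11_eq_nested' {M : Type*} [AddCommMonoid M] (f : (Fin 3 → ℤ) → M) :
    ∑ bb ∈ box11, f bb = ∑ i ∈ icc11, ∑ j ∈ icc11, ∑ k ∈ icc11, f ![i, j, k] := by
  rw [← Finset.sum_product', ← Finset.sum_product']
  symm
  refine Finset.sum_nbij' (fun p => ![p.1.1, p.1.2, p.2]) (fun b => ((b 0, b 1), b 2)) ?_ ?_ ?_ ?_ ?_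
  · intro p hp
    simp only [Finset.mem_product] at hp
    simp only [box11, Fintype.mem_piFinset]
    intro i; fin_cases i
    · exact hp.1.1
    · exact hp.1.2
    · exact hp.2
  · intro b hb
    simp only [box11, Fintype.mem_piFinset] at hb
    simp only [Finset.mem_product]
    exact ⟨⟨hb 0, hb 1⟩, hb 2⟩
  · intro p _; rfl
  · intro b _; exact vec3_eta b
  · intro p _; rfl

/-- The `box11` sum as nested LIST sums over `icc11L`. [formal bookkeeping] -/
theorem sum_box11_eq_lists (f : (Fin 3 → ℤ) → ℝ) :
    ∑ bb ∈ box11, f bb = (icc11L.map fun i => (icc11L.map fun j => (icc11L.map fun k => f ![i, j, k]).sum).sum).sum := by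
  rw [sum_box11_eq_nested', sum_icc11_eq_list]
  refine congrArg _ (List.map_congr_left fun i _ => ?_)
  rw [sum_icc11_eq_list]
  refine congrArg _ (List.map_congr_left fun j _ => ?_)
  rw [sum_icc11_eq_list]

/-- ★★ `A`-family: the fold dominates the box sum up to the signed functional `Λ_A`. [folklore] -/
theorem famA_sound {en : Fin 3 → ℤ} {ed : ℕ} (hed : 0 < ed) {sn : ℤ} {sd : ℕ} (hsd : 0 < sd) {τ : ℝ} (h0 : 0 ≤ τ)
    (hs : τ ≤ (sn : ℝ) / sd) {c w : (Fin 3 × Fin 3) ⊕ Fin 3 → ℤ} {U U₀ : E3 →L[ℝ] E3} (hU : ‖U - 1‖ ≤ 1 / 4)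
    (hbox : ∀ ab : Fin 3 × Fin 3, |(U (EuclideanSpace.single ab.2 (1 : ℝ))) ab.1 - (c (Sum.inl ab) : ℝ) / SC| ≤ (w (Sum.inl ab) : ℝ) / SC)
    (hU₀ : ∀ ab : Fin 3 × Fin 3, (U₀ (EuclideanSpace.single ab.2 (1 : ℝ))) ab.1 = (c (Sum.inl ab) : ℝ) / SC)
    (hok : (famA en ed sn sd c w).ok = true) :
    ∃ κ : Fin 3 × Fin 3 → ℝ, ∃ σ : Fin 3 → ℝ, (∀ ac, FI.mem (κ ac) ((famA en ed sn sd c w).K ac)) ∧ (∀ a, FI.mem (σ a) ((famA en ed sn sd c w).S a)) ∧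
      (∑ bb ∈ box11, cutSlope (latPt U hexFrame bb) (dirVec en ed) τ) * SC ≤
        ((famA en ed sn sd c w).val : ℝ) + (famA en ed sn sd c w).nv + ((famA en ed sn sd c w).rem : ℝ) / 2 +
          SC * ∑ ac : Fin 3 × Fin 3, ((U (EuclideanSpace.single ac.2 (1 : ℝ))) ac.1 - (c (Sum.inl ac) : ℝ) / SC) * κ ac := by
  have hΛ0 : (fun (κ : Fin 3 × Fin 3 → ℝ) (_σ : Fin 3 → ℝ) =>
      ∑ ac : Fin 3 × Fin 3, ((U (EuclideanSpace.single ac.2 (1 : ℝ))) ac.1 - (c (Sum.inl ac) : ℝ) / SC) * κ ac) 0 0 = 0 := by simp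
  have hΛ : ∀ (κ₁ : Fin 3 × Fin 3 → ℝ) (σ₁ : Fin 3 → ℝ) (κ₂ : Fin 3 × Fin 3 → ℝ) (σ₂ : Fin 3 → ℝ),
      (fun (κ : Fin 3 × Fin 3 → ℝ) (_σ : Fin 3 → ℝ) =>
        ∑ ac : Fin 3 × Fin 3, ((U (EuclideanSpace.single ac.2 (1 : ℝ))) ac.1 - (c (Sum.inl ac) : ℝ) / SC) * κ ac) (κ₁ + κ₂) (σ₁ + σ₂) =
      (fun (κ : Fin 3 × Fin 3 → ℝ) (_σ : Fin 3 → ℝ) =>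
        ∑ ac : Fin 3 × Fin 3, ((U (EuclideanSpace.single ac.2 (1 : ℝ))) ac.1 - (c (Sum.inl ac) : ℝ) / SC) * κ ac) κ₁ σ₁ +
      (fun (κ : Fin 3 × Fin 3 → ℝ) (_σ : Fin 3 → ℝ) =>
        ∑ ac : Fin 3 × Fin 3, ((U (EuclideanSpace.single ac.2 (1 : ℝ))) ac.1 - (c (Sum.inl ac) : ℝ) / SC) * κ ac) κ₂ σ₂ := by
    intros; simp only [Pi.add_apply, mul_add, Finset.sum_add_distrib]
  have l3 := fun i j => foldAcc_sound _ hΛ0 hΛ (fun k => contribA en ed sn sd w (boxE c w) (cenE c) ![i, j, k])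
    (fun k => cutSlope (latPt U hexFrame ![i, j, k]) (dirVec en ed) τ) (fun k hk => contribA_sound hed hsd h0 hs hU hbox hU₀ _ hk) icc11L
  have l2 := fun i => foldAcc_sound _ hΛ0 hΛ (fun j => foldAcc (fun k => contribA en ed sn sd w (boxE c w) (cenE c) ![i, j, k]) icc11L)
    (fun j => (icc11L.map fun k => cutSlope (latPt U hexFrame ![i, j, k]) (dirVec en ed) τ).sum) (fun j hj => l3 i j hj) icc11L
  have l1 := foldAcc_sound _ hΛ0 hΛ
    (fun i => foldAcc (fun j => foldAcc (fun k => contribA en ed sn sd w (boxE c w) (cenE c) ![i, j, k]) icc11L) icc11L)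
    (fun i => (icc11L.map fun j => (icc11L.map fun k => cutSlope (latPt U hexFrame ![i, j, k]) (dirVec en ed) τ).sum).sum)
    (fun i hi => l2 i hi) icc11L hok
  rw [sum_box11_eq_lists]
  exact l1

/-- ★★ `B`-family: the fold dominates the box sum up to the signed functional `Λ_B`. [folklore] -/
theorem famB_sound {en : Fin 3 → ℤ} {ed : ℕ} (hed : 0 < ed) {sn : ℤ} {sd : ℕ} (hsd : 0 < sd) {τ : ℝ} (h0 : 0 ≤ τ)
    (hs : τ ≤ (sn : ℝ) / sd) {c w : (Fin 3 × Fin 3) ⊕ Fin 3 → ℤ} {U U₀ : E3 →L[ℝ] E3} {ξ ξ₀ : E3} (hU : ‖U - 1‖ ≤ 1 / 4) (hξn : ‖ξ‖ ≤ 1 / 4)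
    (hbox : ∀ ab : Fin 3 × Fin 3, |(U (EuclideanSpace.single ab.2 (1 : ℝ))) ab.1 - (c (Sum.inl ab) : ℝ) / SC| ≤ (w (Sum.inl ab) : ℝ) / SC)
    (hξ : ∀ i : Fin 3, |ξ i - (c (Sum.inr i) : ℝ) / SC| ≤ (w (Sum.inr i) : ℝ) / SC)
    (hU₀ : ∀ ab : Fin 3 × Fin 3, (U₀ (EuclideanSpace.single ab.2 (1 : ℝ))) ab.1 = (c (Sum.inl ab) : ℝ) / SC)
    (hξ₀ : ∀ i : Fin 3, ξ₀ i = (c (Sum.inr i) : ℝ) / SC) (hok : (famB en ed sn sd c w).ok = true) :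
    ∃ κ : Fin 3 × Fin 3 → ℝ, ∃ σ : Fin 3 → ℝ, (∀ ac, FI.mem (κ ac) ((famB en ed sn sd c w).K ac)) ∧ (∀ a, FI.mem (σ a) ((famB en ed sn sd c w).S a)) ∧
      (∑ bb ∈ box11, cutSlope (latPt U hexFrame bb + U (hcpShift + ξ)) (dirVec en ed) τ) * SC ≤
        ((famB en ed sn sd c w).val : ℝ) + (famB en ed sn sd c w).nv + ((famB en ed sn sd c w).rem : ℝ) / 2 +
          SC * (∑ ac : Fin 3 × Fin 3, ((U (EuclideanSpace.single ac.2 (1 : ℝ))) ac.1 - (c (Sum.inl ac) : ℝ) / SC) * κ ac +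
            ∑ i : Fin 3, (ξ i - (c (Sum.inr i) : ℝ) / SC) * ∑ a : Fin 3, ((c (Sum.inl (a, i)) : ℝ) / SC) * σ a +
            ∑ a : Fin 3, ∑ i : Fin 3, ((U (EuclideanSpace.single i (1 : ℝ))) a - (c (Sum.inl (a, i)) : ℝ) / SC) *
              (ξ i - (c (Sum.inr i) : ℝ) / SC) * σ a) := by
  have hΛ0 : (fun (κ : Fin 3 × Fin 3 → ℝ) (σ : Fin 3 → ℝ) =>
      ∑ ac : Fin 3 × Fin 3, ((U (EuclideanSpace.single ac.2 (1 : ℝ))) ac.1 - (c (Sum.inl ac) : ℝ) / SC) * κ ac +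
      ∑ i : Fin 3, (ξ i - (c (Sum.inr i) : ℝ) / SC) * ∑ a : Fin 3, ((c (Sum.inl (a, i)) : ℝ) / SC) * σ a +
      ∑ a : Fin 3, ∑ i : Fin 3, ((U (EuclideanSpace.single i (1 : ℝ))) a - (c (Sum.inl (a, i)) : ℝ) / SC) *
        (ξ i - (c (Sum.inr i) : ℝ) / SC) * σ a) 0 0 = 0 := by simp
  have hΛ : ∀ (κ₁ : Fin 3 × Fin 3 → ℝ) (σ₁ : Fin 3 → ℝ) (κ₂ : Fin 3 × Fin 3 → ℝ) (σ₂ : Fin 3 → ℝ),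
      (fun (κ : Fin 3 × Fin 3 → ℝ) (σ : Fin 3 → ℝ) =>
      ∑ ac : Fin 3 × Fin 3, ((U (EuclideanSpace.single ac.2 (1 : ℝ))) ac.1 - (c (Sum.inl ac) : ℝ) / SC) * κ ac +
      ∑ i : Fin 3, (ξ i - (c (Sum.inr i) : ℝ) / SC) * ∑ a : Fin 3, ((c (Sum.inl (a, i)) : ℝ) / SC) * σ a +
      ∑ a : Fin 3, ∑ i : Fin 3, ((U (EuclideanSpace.single i (1 : ℝ))) a - (c (Sum.inl (a, i)) : ℝ) / SC) *
        (ξ i - (c (Sum.inr i) : ℝ) / SC) * σ a) (κ₁ + κ₂) (σ₁ + σ₂) =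
      (fun (κ : Fin 3 × Fin 3 → ℝ) (σ : Fin 3 → ℝ) =>
      ∑ ac : Fin 3 × Fin 3, ((U (EuclideanSpace.single ac.2 (1 : ℝ))) ac.1 - (c (Sum.inl ac) : ℝ) / SC) * κ ac +
      ∑ i : Fin 3, (ξ i - (c (Sum.inr i) : ℝ) / SC) * ∑ a : Fin 3, ((c (Sum.inl (a, i)) : ℝ) / SC) * σ a +
      ∑ a : Fin 3, ∑ i : Fin 3, ((U (EuclideanSpace.single i (1 : ℝ))) a - (c (Sum.inl (a, i)) : ℝ) / SC) *
        (ξ i - (c (Sum.inr i) : ℝ) / SC) * σ a) κ₁ σ₁ +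
      (fun (κ : Fin 3 × Fin 3 → ℝ) (σ : Fin 3 → ℝ) =>
      ∑ ac : Fin 3 × Fin 3, ((U (EuclideanSpace.single ac.2 (1 : ℝ))) ac.1 - (c (Sum.inl ac) : ℝ) / SC) * κ ac +
      ∑ i : Fin 3, (ξ i - (c (Sum.inr i) : ℝ) / SC) * ∑ a : Fin 3, ((c (Sum.inl (a, i)) : ℝ) / SC) * σ a +
      ∑ a : Fin 3, ∑ i : Fin 3, ((U (EuclideanSpace.single i (1 : ℝ))) a - (c (Sum.inl (a, i)) : ℝ) / SC) *
        (ξ i - (c (Sum.inr i) : ℝ) / SC) * σ a) κ₂ σ₂ := by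
    intros
    simp only [Pi.add_apply, mul_add, Finset.sum_add_distrib, Finset.mul_sum]
    ring
  have l3 := fun i j => foldAcc_sound _ hΛ0 hΛ (fun k => contribB en ed sn sd c w (boxE c w) (cenE c) (shufFI c w) (cenX c) ![i, j, k])
    (fun k => cutSlope (latPt U hexFrame ![i, j, k] + U (hcpShift + ξ)) (dirVec en ed) τ)
    (fun k hk => contribB_sound hed hsd h0 hs hU hξn hbox hξ hU₀ hξ₀ _ hk) icc11L
  have l2 := fun i => foldAcc_sound _ hΛ0 hΛ
    (fun j => foldAcc (fun k => contribB en ed sn sd c w (boxE c w) (cenE c) (shufFI c w) (cenX c) ![i, j, k]) icc11L)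
    (fun j => (icc11L.map fun k => cutSlope (latPt U hexFrame ![i, j, k] + U (hcpShift + ξ)) (dirVec en ed) τ).sum) (fun j hj => l3 i j hj) icc11L
  have l1 := foldAcc_sound _ hΛ0 hΛ
    (fun i => foldAcc (fun j => foldAcc (fun k => contribB en ed sn sd c w (boxE c w) (cenE c) (shufFI c w) (cenX c) ![i, j, k]) icc11L) icc11L)
    (fun i => (icc11L.map fun j => (icc11L.map fun k => cutSlope (latPt U hexFrame ![i, j, k] + U (hcpShift + ξ)) (dirVec en ed) τ).sum).sum)
    (fun i hi => l2 i hi) icc11L hok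
  rw [sum_box11_eq_lists]
  exact l1

end Summit.AtomisticToContinuum.Crystallization.Theorems.FrustratedLawDichotomyStrainedPatchHomForceCentredFam
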